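import Mathlib
import Literature.Combinatorics.Optimization.PathDecomposableMulticuts
import HarnessLib

/-!
# Sparse edge sets with large girth are path decomposable (Arora–Bollobás–Lovász–Tourlakis,
# Lemma 2.12, in the hereditary form of `Multicut.PathDecomposable`)

[topic Combinatorics/Optimization]

[AroraBollobasLovaszTourlakis2006] Lemma 2.12 (p. 28): "Let `ℓ ≥ 1` be an integer and
`0 < η < 1/(3ℓ−1)`, and let `G` be a `2`-connected `(1+η)`-sparse graph which is not a cycle. Then
`G` contains a path of length at least `ℓ + 1` whose internal vertices have degree `2` in `G`.
Proof. … `G` consists of a certain `k ≥ 2` number of branch-vertices (i.e., vertices of degree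
at least `3`) and the induced paths joining them … `m − k ≤ ηn` … hence `η ≥ 1/(3ℓ−1)`, a
contradiction."  Together with "If it is a cycle then its length must be at least `2h`" (proof of
Lemma 2.13) this is the deterministic half of the random-graph input of the CMM MAX-CUT gap
(`MaxCutGapGraphs.lean`, [CharikarMakarychevMakarychev2010] Lemma 3.6: "every `1 + η` sparse
graph with girth `Ω(1/η)` is `Ω(1/η)`-path decomposable").

This file proves that statement in the vocabulary of `PathDecomposableMulticuts.lean`: a loopless
edge set `E` all of whose sub-edge-sets `E'` are `(1+η)`-sparse (`|E'| ≤ (1+η)|supp E'|`) and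
whose cycles have length `≥ l + 1` is `l`-path decomposable in the hereditary sense
(`Multicut.PathDecomposable l E`), for `η(6l + 14) ≤ 1` (`pathDecomposable_of_sparse`).  The
argument follows the print with the branch vertices `B` (edge-degree `≥ 3`) and the degree-`2`
vertices `D₂` of a non-separable `E'` (all its vertices have edge-degree `≥ 2`,
`two_le_edeg_of_not_separable`): `|B| ≤ 2(e − n)`; the edges inside `D₂` form a graph `F` of
maximum degree `2` with `≥ 2(n − |B|) − e` edges, hence `≤ 6(e−n)` vertices of `F`-degree `≤ 1`;
if `F` has a cycle, `E'` is that cycle (length `≥ l+1`); otherwise every `F`-component is a path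
with an end of `F`-degree `≤ 1`, so some component has `≥ |D₂|/(6(e−n)) ≥ l + 2` vertices and a
geodesic in it is the sought path (the printed count `m ≥ 3k/2` is replaced by this degree count;
the constant `1/(3ℓ−1)` becomes `1/(6l+14)`).  Everything is proved; no named facts.

## References

* [AroraBollobasLovaszTourlakis2006] S. Arora, B. Bollobás, L. Lovász, I. Tourlakis, *Proving
  integrality gaps without knowing the linear program*, Theory of Computing 2 (2006) 19–51,
  Lemma 2.12 (p. 28) and the proof of Lemma 2.13.  Held text `paper:doi-10-1109-sfcs-2002-1181954`.
* [CharikarMakarychevMakarychev2010] SIAM J. Comput. 39 (2010), Def. 3.2, Lemma 3.6.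
-/

noncomputable section

open Finset SimpleGraph

namespace Literature.Combinatorics.Optimization

namespace Multicut

variable {V : Type*} [Fintype V] [DecidableEq V]

/-! ### Edge degrees -/

/-- The number of edges of `E` at `v`. [cite: AroraBollobasLovaszTourlakis2006, Lemma 2.12 proof (p. 28: "vertices of degree at least 3")] -/
def edeg (E : Finset (Sym2 V)) (v : V) : ℕ := (E.filter fun e => v ∈ e).card

omit [Fintype V] in
/-- Monotonicity of the edge degree. [cite: AroraBollobasLovaszTourlakis2006, Lemma 2.12 proof (p. 28)] -/
theorem edeg_mono {A E : Finset (Sym2 V)} (h : A ⊆ E) (v : V) : edeg A v ≤ edeg E v :=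
  card_le_card (filter_subset_filter _ h)

omit [Fintype V] in
/-- A vertex off the support has edge degree `0`. [cite: AroraBollobasLovaszTourlakis2006, Lemma 2.12 proof (p. 28)] -/
theorem edeg_eq_zero_of_notMem_supp {E : Finset (Sym2 V)} {v : V} (hv : v ∉ supp E) : edeg E v = 0 := by
  rw [edeg, card_eq_zero, filter_eq_empty_iff]
  exact fun e he hve => hv (mem_supp.2 ⟨e, he, hve⟩)

omit [Fintype V] in
/-- A vertex of the support has positive edge degree. [cite: AroraBollobasLovaszTourlakis2006, Lemma 2.12 proof (p. 28)] -/
theorem edeg_pos_of_mem_supp {E : Finset (Sym2 V)} {v : V} (hv : v ∈ supp E) : 0 < edeg E v := by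
  obtain ⟨e, he, hve⟩ := mem_supp.1 hv
  exact card_pos.2 ⟨e, mem_filter.2 ⟨he, hve⟩⟩

omit [Fintype V] in
/-- **Handshake**: `Σ_{v ∈ supp E} edeg v = 2|E|` for loopless `E`.
[cite: AroraBollobasLovaszTourlakis2006, Lemma 2.12 proof (p. 28: "n = k + Σ(ℓᵢ − 1) = k − m + e(G)")] -/
theorem sum_edeg (E : Finset (Sym2 V)) (hloop : ∀ e ∈ E, ¬ e.IsDiag) :
    ∑ v ∈ supp E, edeg E v = 2 * E.card := by
  have h := Finset.sum_card_bipartiteAbove_eq_sum_card_bipartiteBelow (s := supp E) (t := E)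
    (r := fun (v : V) (e : Sym2 V) => v ∈ e)
  simp only [bipartiteAbove, bipartiteBelow] at h
  unfold edeg
  rw [h]
  have : ∀ e ∈ E, ((supp E).filter fun v => v ∈ e).card = 2 := by
    intro e he
    induction e using Sym2.ind with
    | h x y =>
      have hxy : x ≠ y := fun h => hloop _ he (by subst h; simp)
      have : (supp E).filter (fun v => v ∈ s(x, y)) = {x, y} := by
        ext v
        simp only [mem_filter, Sym2.mem_iff, mem_insert, mem_singleton]
        constructor
        · exact fun h => h.2
        · rintro (rfl | rfl)
          · exact ⟨mem_supp.2 ⟨_, he, Sym2.mem_mk_left _ _⟩, Or.inl rfl⟩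
          · exact ⟨mem_supp.2 ⟨_, he, Sym2.mem_mk_right _ _⟩, Or.inr rfl⟩
      rw [this, card_pair hxy]
  rw [Finset.sum_congr rfl this, sum_const, smul_eq_mul, mul_comm]

omit [Fintype V] in
/-- Two distinct edges at a vertex of edge degree `2` are all its edges.
[cite: AroraBollobasLovaszTourlakis2006, Lemma 2.12 (p. 28: "internal vertices have degree 2")] -/
theorem eq_or_eq_of_edeg_two {E : Finset (Sym2 V)} {v : V} (hv : edeg E v = 2) {e₁ e₂ : Sym2 V}
    (h₁ : e₁ ∈ E) (h₂ : e₂ ∈ E) (hv₁ : v ∈ e₁) (hv₂ : v ∈ e₂) (hne : e₁ ≠ e₂) {e : Sym2 V}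
    (he : e ∈ E) (hve : v ∈ e) : e = e₁ ∨ e = e₂ := by
  by_contra hcon
  push Not at hcon
  have hsub : ({e₁, e₂, e} : Finset (Sym2 V)) ⊆ E.filter fun e => v ∈ e := by
    intro f hf
    simp only [mem_insert, mem_singleton] at hf
    rcases hf with rfl | rfl | rfl
    · exact mem_filter.2 ⟨h₁, hv₁⟩
    · exact mem_filter.2 ⟨h₂, hv₂⟩
    · exact mem_filter.2 ⟨he, hve⟩
  have hcard : ({e₁, e₂, e} : Finset (Sym2 V)).card = 3 := by
    rw [card_insert_of_notMem, card_pair (Ne.symm hcon.2)]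
    simp only [mem_insert, mem_singleton, not_or]
    exact ⟨hne, (Ne.symm hcon.1)⟩
  have := card_le_card hsub
  rw [hcard] at this
  unfold edeg at hv
  omega

omit [Fintype V] in
/-- The interior of a path whose interior vertices have edge degree `2` is untouched by the other
edges. [cite: AroraBollobasLovaszTourlakis2006, Lemma 2.12 (p. 28)] -/
theorem bare_of_edeg_two {E : Finset (Sym2 V)} {a : ℕ → V} {m : ℕ}
    (ha : ∀ i j, i ≤ m → j ≤ m → a i = a j → i = j) (hP : pathEdges a m ⊆ E)
    (hdeg : ∀ k, 0 < k → k < m → edeg E (a k) = 2) :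
    ∀ k, 0 < k → k < m → a k ∉ supp (E \ pathEdges a m) := by
  intro k hk hkm h
  obtain ⟨e, he, hke⟩ := mem_supp.1 h
  rw [mem_sdiff] at he
  have h₁ : s(a (k - 1), a k) ∈ pathEdges a m := by
    have := edge_mem_pathEdges (a := a) (m := m) (k := k - 1) (by omega)
    rwa [show k - 1 + 1 = k by omega] at this
  have h₂ : s(a k, a (k + 1)) ∈ pathEdges a m := edge_mem_pathEdges hkm
  have hne : s(a (k - 1), a k) ≠ s(a k, a (k + 1)) := by
    intro heq
    have : a (k - 1) ∈ (s(a k, a (k + 1)) : Sym2 V) := by rw [← heq]; exact Sym2.mem_mk_left _ _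
    rcases Sym2.mem_iff.1 this with h | h
    · have := ha _ _ (by omega) (by omega) h; omega
    · have := ha _ _ (by omega) (by omega) h; omega
  rcases eq_or_eq_of_edeg_two (hdeg k hk hkm) (hP h₁) (hP h₂) (Sym2.mem_mk_right _ _)
    (Sym2.mem_mk_left _ _) hne he.1 hke with rfl | rfl
  · exact he.2 h₁
  · exact he.2 h₂

/-! ### Non-separable edge sets have minimum edge degree `2` -/

omit [Fintype V] in
/-- **A vertex of edge degree `1` is a one-point separation** (`{e} ⊔ (E ∖ {e})` glued at the other
endpoint of `e`); hence every vertex of a non-separable edge set with `≥ 2` edges lies on `≥ 2`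
edges ("`G` is `2`-connected"). [cite: AroraBollobasLovaszTourlakis2006, Lemma 2.12 (p. 28); CharikarMakarychevMakarychev2010, §3.1 items 2–3 (p. 15)] -/
theorem two_le_edeg_of_not_separable {E : Finset (Sym2 V)} (hsep : ¬ Separable E) (h2 : 2 ≤ E.card)
    {v : V} (hv : v ∈ supp E) : 2 ≤ edeg E v := by
  by_contra hlt
  have h1 : edeg E v = 1 := by have := edeg_pos_of_mem_supp hv; omega
  obtain ⟨e₀, he₀⟩ := card_eq_one.1 h1
  have hmem : e₀ ∈ E.filter fun e => v ∈ e := by rw [he₀]; exact mem_singleton_self _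
  obtain ⟨he₀E, hve₀⟩ := mem_filter.1 hmem
  have huniq : ∀ e ∈ E, v ∈ e → e = e₀ := fun e he hve => by
    have : e ∈ E.filter fun e => v ∈ e := mem_filter.2 ⟨he, hve⟩
    rw [he₀] at this; exact mem_singleton.1 this
  -- the other endpoint `w` of `e₀`
  obtain ⟨w, hw⟩ : ∃ w, e₀ = s(v, w) := by
    induction e₀ using Sym2.ind with
    | h x y =>
      rcases Sym2.mem_iff.1 hve₀ with rfl | rfl
      · exact ⟨y, rfl⟩
      · exact ⟨x, Sym2.eq_swap⟩
  apply hsep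
  refine ⟨{e₀}, E.erase e₀, w, ?_, ?_, singleton_nonempty _, ?_, ?_⟩
  · rw [← insert_eq, insert_erase he₀E]
  · exact disjoint_singleton_left.2 (notMem_erase _ _)
  · have : (E.erase e₀).card = E.card - 1 := card_erase_of_mem he₀E
    exact card_pos.1 (by omega)
  · intro x hxA hxB
    obtain ⟨e, he, hxe⟩ := mem_supp.1 hxA
    rw [mem_singleton] at he; subst he
    obtain ⟨f, hf, hxf⟩ := mem_supp.1 hxB
    rw [hw] at hxe
    rcases Sym2.mem_iff.1 hxe with rfl | rfl
    · exact absurd (huniq f (mem_of_mem_erase hf) hxf) (ne_of_mem_erase hf)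
    · rfl

/-! ### Graphs of maximum edge degree `2`: spheres have at most one point beyond a leaf -/

omit [Fintype V] [DecidableEq V] in
/-- In `gr A`, a vertex at distance `r + 1` from `w` has a neighbour at distance `r`.
[cite: AroraBollobasLovaszTourlakis2006, Lemma 2.12 proof (p. 28: "the induced paths joining them")] -/
theorem exists_adj_dist_eq {A : Finset (Sym2 V)} {w y : V} (hr : (gr A).Reachable w y) {r : ℕ}
    (hd : (gr A).dist w y = r + 1) :
    ∃ z, (gr A).Adj z y ∧ (gr A).Reachable w z ∧ (gr A).dist w z = r := by
  obtain ⟨p, hp, hlen⟩ := hr.exists_path_of_dist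
  have hne : ¬ p.Nil := by
    intro h; have := SimpleGraph.Walk.length_eq_zero_iff.2 h; omega
  refine ⟨p.penultimate, p.adj_penultimate hne, p.dropLast.reachable, le_antisymm ?_ ?_⟩
  · have := dist_le p.dropLast
    rw [Walk.length_dropLast, hlen, hd] at this
    simpa using this
  · -- a walk to `z` plus the last edge is a walk to `y`
    obtain ⟨q, hq⟩ := p.dropLast.reachable.exists_walk_length_eq_dist
    have := dist_le (q.concat (p.adj_penultimate hne))
    rw [Walk.length_concat, hq, hd] at this
    omega

omit [Fintype V] in
/-- **Spheres beyond a vertex of edge degree `≤ 1` have at most one point** when all edge degrees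
are `≤ 2` (the component of such a vertex is a path starting there).
[cite: AroraBollobasLovaszTourlakis2006, Lemma 2.12 proof (p. 28)] -/
theorem sphere_subsingleton {A : Finset (Sym2 V)}
    (hdeg : ∀ v, edeg A v ≤ 2) {w : V} (hw : edeg A w ≤ 1) :
    ∀ r : ℕ, 1 ≤ r → ∀ y y' : V, (gr A).Reachable w y → (gr A).dist w y = r →
      (gr A).Reachable w y' → (gr A).dist w y' = r → y = y' := by
  -- distinct neighbours give distinct edges at a vertex
  have hedges : ∀ z : V, ∀ s : Finset V, (∀ y ∈ s, (gr A).Adj z y) → s.card ≤ edeg A z := by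
    intro z s hs
    refine Finset.card_le_card_of_injOn (fun y => s(z, y)) (fun y hy => ?_) (fun y _ y' _ h => ?_)
    · exact mem_coe.2 (mem_filter.2 ⟨(gr_adj.1 (hs y hy)).1, Sym2.mem_mk_left _ _⟩)
    · simpa using (Sym2.congr_right (a := z)).1 h
  intro r
  induction r with
  | zero => intro h; omega
  | succ r ih =>
    intro _ y y' hy hdy hy' hdy'
    by_contra hne
    obtain ⟨z, hzy, hz, hdz⟩ := exists_adj_dist_eq hy hdy
    obtain ⟨z', hzy', hz', hdz'⟩ := exists_adj_dist_eq hy' hdy'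
    rcases Nat.eq_zero_or_pos r with hr0 | hrpos
    · -- `r = 0`: both are neighbours of `w`
      subst hr0
      have hzw : z = w := ((Reachable.dist_eq_zero_iff hz).1 hdz).symm
      have hz'w : z' = w := ((Reachable.dist_eq_zero_iff hz').1 hdz').symm
      rw [hzw] at hzy; rw [hz'w] at hzy'
      have := hedges w {y, y'} (fun x hx => by
        simp only [mem_insert, mem_singleton] at hx
        rcases hx with rfl | rfl
        · exact hzy
        · exact hzy')
      rw [card_pair hne] at this
      omega
    · have hzz : z = z' := ih hrpos z z' hz hdz hz' hdz'
      subst hzz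
      obtain ⟨x, hxz, hx, hdx⟩ := exists_adj_dist_eq hz (r := r - 1) (by rw [hdz]; omega)
      have hxy : x ≠ y := by rintro rfl; omega
      have hxy' : x ≠ y' := by rintro rfl; omega
      have := hedges z {x, y, y'} (fun v hv => by
        simp only [mem_insert, mem_singleton] at hv
        rcases hv with rfl | rfl | rfl
        · exact hxz.symm
        · exact hzy
        · exact hzy')
      rw [card_insert_of_notMem (by simp [hxy, hxy']), card_pair hne] at this
      have := hdeg z
      omega

omit [Fintype V] in
/-- Hence the ball of radius `R` around such a vertex has at most `R + 1` points, and a set of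
`≥ R + 2` vertices reachable from it contains one at distance `≥ R + 1`.
[cite: AroraBollobasLovaszTourlakis2006, Lemma 2.12 proof (p. 28)] -/
theorem exists_far_of_card {A : Finset (Sym2 V)}
    (hdeg : ∀ v, edeg A v ≤ 2) {w : V} (hw : edeg A w ≤ 1) (C : Finset V)
    (hC : ∀ y ∈ C, (gr A).Reachable w y) {R : ℕ} (hcard : R + 2 ≤ C.card) :
    ∃ y ∈ C, R + 1 ≤ (gr A).dist w y := by
  classical
  by_contra hcon
  push Not at hcon
  -- `C` maps into the distances `0..R`, with singleton fibres over `r ≥ 1` and fibre `{w}` over `0`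
  have hmaps : ∀ y ∈ C, (gr A).dist w y ∈ range (R + 1) := fun y hy => mem_range.2 (hcon y hy)
  have hfib : ∀ r ∈ range (R + 1), (C.filter fun y => (gr A).dist w y = r).card ≤ 1 := by
    intro r _
    refine card_le_one.2 fun y hy y' hy' => ?_
    obtain ⟨hyC, hdy⟩ := mem_filter.1 hy
    obtain ⟨hy'C, hdy'⟩ := mem_filter.1 hy'
    rcases Nat.eq_zero_or_pos r with rfl | hr
    · exact ((Reachable.dist_eq_zero_iff (hC y hyC)).1 hdy).symm.trans
        ((Reachable.dist_eq_zero_iff (hC y' hy'C)).1 hdy')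
    · exact sphere_subsingleton hdeg hw r hr y y' (hC y hyC) hdy (hC y' hy'C) hdy'
  have := Finset.card_le_mul_card_image_of_maps_to (f := fun y => (gr A).dist w y) hmaps 1
    (fun r hr => hfib r hr)
  rw [card_range, one_mul] at this
  omega

/-! ### The main lemma -/

omit [Fintype V] [DecidableEq V] in
/-- Cycles of a sub-edge-set are cycles of the edge set. [cite: AroraBollobasLovaszTourlakis2006, Lemma 2.13 proof (p. 28)] -/
theorem girth_mono {A E : Finset (Sym2 V)} (h : A ⊆ E) {g : ℕ}
    (hgirth : ∀ (u : V) (c : (gr E).Walk u u), c.IsCycle → g ≤ c.length) :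
    ∀ (u : V) (c : (gr A).Walk u u), c.IsCycle → g ≤ c.length := by
  intro u c hc
  have hedges : ∀ e ∈ c.edges, e ∈ (gr E).edgeSet := fun e he =>
    edgeSet_mono (gr_mono h) (c.edges_subset_edgeSet he)
  have := hgirth u (c.transfer (gr E) hedges) (hc.transfer hedges)
  rwa [Walk.length_transfer] at this


/-- Endpoints of an edge all of whose vertices lie in `D` lie in `D`. [cite: AroraBollobasLovaszTourlakis2006, Lemma 2.12 proof (p. 28)] -/
theorem mem_of_adj_filter {E : Finset (Sym2 V)} {D : Finset V} {x y : V}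
    (h : (gr (E.filter fun e => ∀ v ∈ e, v ∈ D)).Adj x y) : x ∈ D ∧ y ∈ D := by
  have hm := (mem_filter.1 (gr_adj.1 h).1).2
  exact ⟨hm x (Sym2.mem_mk_left _ _), hm y (Sym2.mem_mk_right _ _)⟩

/-- **[ABLT06] Lemma 2.12 for one edge set**: a non-separable loopless edge set `E` with `≥ 2`
edges, `(1+η)`-sparse (`|E| ≤ (1+η)|supp E|`, `η(6l+14) ≤ 1`), all of whose cycles have length
`≥ l + 1`, contains a path of length `≥ l` with pairwise distinct vertices whose interior vertices
lie on no other edge of `E`.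
[cite: AroraBollobasLovaszTourlakis2006, Lemma 2.12 (p. 28) and proof of Lemma 2.13 ("If it is a cycle then its length must be at least 2h")] -/
theorem exists_barePath_of_sparse {E : Finset (Sym2 V)} (hsep : ¬ Separable E) (h2 : 2 ≤ E.card)
    (hloop : ∀ e ∈ E, ¬ e.IsDiag) {η : ℝ} {l : ℕ} (hη : η * (6 * l + 14) ≤ 1)
    (hsparse : (E.card : ℝ) ≤ (1 + η) * (supp E).card)
    (hgirth : ∀ (u : V) (c : (gr E).Walk u u), c.IsCycle → l + 1 ≤ c.length) :
    ∃ (a : ℕ → V) (n : ℕ), l ≤ n ∧ (∀ i j, i ≤ n → j ≤ n → a i = a j → i = j) ∧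
      pathEdges a n ⊆ E ∧ ∀ k, 0 < k → k < n → a k ∉ supp (E \ pathEdges a n) := by
  classical
  -- degree-2 vertices, branch vertices, the edges inside `D₂`
  set S := supp E with hS
  set D₂ := S.filter fun v => edeg E v = 2 with hD₂
  set E₂ := E.filter fun e => ∀ v ∈ e, v ∈ D₂ with hE₂
  have hE₂E : E₂ ⊆ E := filter_subset _ _
  have hloop₂ : ∀ e ∈ E₂, ¬ e.IsDiag := fun e he => hloop e (hE₂E he)
  have hdeg2 : ∀ v ∈ S, 2 ≤ edeg E v := fun v hv => two_le_edeg_of_not_separable hsep h2 hv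
  have hD₂deg : ∀ v ∈ D₂, edeg E v = 2 := fun v hv => (mem_filter.1 hv).2
  have hfdeg : ∀ v, edeg E₂ v ≤ 2 := by
    intro v
    by_cases hv : v ∈ supp E₂
    · obtain ⟨e, he, hve⟩ := mem_supp.1 hv
      have hvD : v ∈ D₂ := (mem_filter.1 he).2 v hve
      exact (edeg_mono hE₂E v).trans (hD₂deg v hvD).le
    · rw [edeg_eq_zero_of_notMem_supp hv]; exact Nat.zero_le _
  -- the bare path extracted from consecutive vertices of a walk in `gr E₂`
  have hbare : ∀ (a : ℕ → V) (n : ℕ), (∀ i j, i ≤ n → j ≤ n → a i = a j → i = j) →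
      (∀ i, i < n → (gr E₂).Adj (a i) (a (i + 1))) →
      pathEdges a n ⊆ E ∧ ∀ k, 0 < k → k < n → a k ∉ supp (E \ pathEdges a n) := by
    intro a n ha hadj
    have hP : pathEdges a n ⊆ E := by
      intro e he
      obtain ⟨i, hi, rfl⟩ := mem_pathEdges.1 he
      exact hE₂E (gr_adj.1 (hadj i hi)).1
    refine ⟨hP, bare_of_edeg_two ha hP fun k hk hkn => hD₂deg _ (mem_of_adj_filter (hadj k hkn)).1⟩
  -- Case 1: the edges inside `D₂` contain a cycle: then that cycle is the sought structure
  by_cases hacyc : ¬ (gr E₂).IsAcyclic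
  · unfold IsAcyclic at hacyc
    push Not at hacyc
    obtain ⟨u, c, hc⟩ := hacyc
    have hlen : l + 1 ≤ c.length := girth_mono hE₂E hgirth u c hc
    have hinj : ∀ i j, i ≤ l → j ≤ l → c.getVert i = c.getVert j → i = j := fun i j hi hj h =>
      hc.getVert_injOn' (by simp; omega) (by simp; omega) h
    obtain ⟨hP, hb⟩ := hbare (fun i => c.getVert i) l hinj fun i hi => c.adj_getVert_succ (by omega)
    exact ⟨fun i => c.getVert i, l, le_rfl, hinj, hP, hb⟩
  push Not at hacyc
  -- Case 2: `gr E₂` is a forest of maximum degree 2.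
  -- Counting: `t` vertices of `D₂` have `E₂`-degree ≤ 1, and `(l+2) t ≤ |D₂|`.
  set T := D₂.filter fun v => edeg E₂ v ≤ 1 with hT
  have hcount : (l + 2) * T.card ≤ D₂.card := by
    -- (A1) `2n + k ≤ 2e` with `k = n − |D₂|`
    have hsum := sum_edeg E hloop
    have hD₂S : D₂ ⊆ S := filter_subset _ _
    have hA1 : 2 * S.card + (S.card - D₂.card) ≤ 2 * E.card := by
      rw [← hsum, ← Finset.sum_filter_add_sum_filter_not S (fun v => edeg E v = 2)]
      have h1 : ∑ v ∈ S.filter (fun v => edeg E v = 2), edeg E v = 2 * D₂.card := by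
        rw [hD₂, Finset.sum_congr rfl fun v hv => (mem_filter.1 hv).2, sum_const, smul_eq_mul, mul_comm]
      have h2' : 3 * (S.filter fun v => ¬ edeg E v = 2).card ≤
          ∑ v ∈ S.filter (fun v => ¬ edeg E v = 2), edeg E v := by
        rw [mul_comm, ← smul_eq_mul, ← sum_const]
        refine sum_le_sum fun v hv => ?_
        obtain ⟨hvS, hv2⟩ := mem_filter.1 hv
        have := hdeg2 v hvS; omega
      have hsplit : (S.filter fun v => edeg E v = 2).card + (S.filter fun v => ¬ edeg E v = 2).card =
          S.card := Finset.card_filter_add_card_filter_not _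
      rw [← hD₂] at hsplit
      omega
    -- (A2) `2|D₂| ≤ e + |E₂|`
    have hA2 : 2 * D₂.card ≤ E.card + E₂.card := by
      have hsum2 : ∑ v ∈ D₂, edeg E v = 2 * D₂.card := by
        rw [Finset.sum_congr rfl fun v hv => hD₂deg v hv, sum_const, smul_eq_mul, mul_comm]
      have hbip := Finset.sum_card_bipartiteAbove_eq_sum_card_bipartiteBelow (s := D₂) (t := E)
        (r := fun (v : V) (e : Sym2 V) => v ∈ e)
      simp only [bipartiteAbove, bipartiteBelow] at hbip
      have hlhs : ∑ v ∈ D₂, edeg E v = ∑ v ∈ D₂, (E.filter fun e => v ∈ e).card := rfl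
      rw [← hsum2, hlhs, hbip, ← Finset.sum_filter_add_sum_filter_not E (fun e => ∀ v ∈ e, v ∈ D₂)]
      rw [← hE₂]
      have hin : ∀ e ∈ E, (D₂.filter fun v => v ∈ e).card ≤ 2 := by
        intro e he
        induction e using Sym2.ind with
        | h x y =>
          calc (D₂.filter fun v => v ∈ s(x, y)).card ≤ ({x, y} : Finset V).card :=
                card_le_card fun v hv => by
                  have := (mem_filter.1 hv).2
                  rcases Sym2.mem_iff.1 this with rfl | rfl <;> simp
            _ ≤ 2 := card_insert_le _ _
      have hout : ∀ e ∈ E.filter (fun e => ¬ ∀ v ∈ e, v ∈ D₂), (D₂.filter fun v => v ∈ e).card ≤ 1 := by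
        intro e he
        obtain ⟨heE, hnot⟩ := mem_filter.1 he
        push Not at hnot
        obtain ⟨v₀, hv₀e, hv₀⟩ := hnot
        induction e using Sym2.ind with
        | h x y =>
          -- the filter misses `v₀ ∈ {x, y}`, so it is inside the other endpoint
          have : (D₂.filter fun v => v ∈ s(x, y)) ⊆ ({x, y} : Finset V).erase v₀ := by
            intro v hv
            obtain ⟨hvD, hve⟩ := mem_filter.1 hv
            refine mem_erase.2 ⟨fun h => hv₀ (h ▸ hvD), ?_⟩
            rcases Sym2.mem_iff.1 hve with rfl | rfl <;> simp
          refine (card_le_card this).trans ?_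
          rw [card_erase_of_mem (by rcases Sym2.mem_iff.1 hv₀e with rfl | rfl <;> simp)]
          have := card_insert_le x ({y} : Finset V)
          simp only [card_singleton] at this ⊢
          omega
      have h1 : ∑ e ∈ E₂, (D₂.filter fun v => v ∈ e).card ≤ 2 * E₂.card := by
        rw [mul_comm, ← smul_eq_mul, ← sum_const]
        exact sum_le_sum fun e he => hin e (hE₂E he)
      have h2' : ∑ e ∈ E.filter (fun e => ¬ ∀ v ∈ e, v ∈ D₂), (D₂.filter fun v => v ∈ e).card ≤
          (E.filter (fun e => ¬ ∀ v ∈ e, v ∈ D₂)).card :=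
        calc ∑ e ∈ E.filter (fun e => ¬ ∀ v ∈ e, v ∈ D₂), (D₂.filter fun v => v ∈ e).card
            ≤ ∑ e ∈ E.filter (fun e => ¬ ∀ v ∈ e, v ∈ D₂), 1 := sum_le_sum fun e he => hout e he
          _ = (E.filter (fun e => ¬ ∀ v ∈ e, v ∈ D₂)).card := by rw [sum_const, smul_eq_mul, mul_one]
      have hsplit : E₂.card + (E.filter (fun e => ¬ ∀ v ∈ e, v ∈ D₂)).card = E.card := by
        rw [hE₂]; exact Finset.card_filter_add_card_filter_not _
      omega
    -- (A3) `t ≤ 2|D₂| − 2|E₂|`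
    have hA3 : T.card + 2 * E₂.card ≤ 2 * D₂.card := by
      have hsum3 : ∑ v ∈ D₂, edeg E₂ v = 2 * E₂.card := by
        rw [← sum_edeg E₂ hloop₂]
        refine (Finset.sum_subset (fun v hv => ?_) fun v _ hv => edeg_eq_zero_of_notMem_supp hv).symm
        obtain ⟨e, he, hve⟩ := mem_supp.1 hv
        exact (mem_filter.1 he).2 v hve
      rw [← hsum3, ← Finset.sum_filter_add_sum_filter_not D₂ (fun v => edeg E₂ v ≤ 1), ← hT]
      have h1 : ∑ v ∈ T, edeg E₂ v ≤ T.card :=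
        calc ∑ v ∈ T, edeg E₂ v ≤ ∑ v ∈ T, 1 := sum_le_sum fun v hv => (mem_filter.1 hv).2
          _ = T.card := by rw [sum_const, smul_eq_mul, mul_one]
      have h2' : ∑ v ∈ D₂.filter (fun v => ¬ edeg E₂ v ≤ 1), edeg E₂ v ≤
          2 * (D₂.filter (fun v => ¬ edeg E₂ v ≤ 1)).card := by
        rw [mul_comm, ← smul_eq_mul, ← sum_const]
        exact sum_le_sum fun v _ => hfdeg v
      have hsplit : T.card + (D₂.filter (fun v => ¬ edeg E₂ v ≤ 1)).card = D₂.card := by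
        rw [hT]; exact Finset.card_filter_add_card_filter_not _
      omega
    -- combine with sparsity (over ℝ)
    have hD₂S : D₂.card ≤ S.card := card_le_card (filter_subset _ _)
    have hreal : ((l + 2 : ℕ) : ℝ) * T.card ≤ D₂.card := by
      have e1 : (2 : ℝ) * S.card + (S.card - D₂.card) ≤ 2 * E.card := by
        have : ((2 * S.card + (S.card - D₂.card) : ℕ) : ℝ) ≤ ((2 * E.card : ℕ) : ℝ) := by
          exact_mod_cast hA1
        push_cast [Nat.cast_sub hD₂S] at this
        linarith
      have e2 : (2 : ℝ) * D₂.card ≤ E.card + E₂.card := by exact_mod_cast hA2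
      have e3 : (T.card : ℝ) + 2 * E₂.card ≤ 2 * D₂.card := by exact_mod_cast hA3
      have hn : (0 : ℝ) ≤ S.card := Nat.cast_nonneg _
      -- `t ≤ 6(e − n)`, `|D₂| ≥ 3n − 2e`, `e ≤ (1+η) n`
      have ht : (T.card : ℝ) ≤ 6 * (E.card - S.card) := by linarith
      have hd : (3 : ℝ) * S.card - 2 * E.card ≤ D₂.card := by linarith
      have hex : (E.card : ℝ) - S.card ≤ η * S.card := by linarith
      have hη0 : 0 ≤ η * S.card := by
        -- `e ≥ n/1`? no: use `t ≥ 0`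
        have : (0 : ℝ) ≤ T.card := Nat.cast_nonneg _
        nlinarith
      push_cast
      have hl0 : (0 : ℝ) ≤ l := Nat.cast_nonneg _
      calc ((l : ℝ) + 2) * T.card ≤ (l + 2) * (6 * (η * S.card)) := by
            refine mul_le_mul_of_nonneg_left (ht.trans ?_) (by linarith)
            linarith
        _ = (η * (6 * l + 14) - 2 * η) * S.card := by ring
        _ ≤ (1 - 2 * η) * S.card := by
            refine mul_le_mul_of_nonneg_right (by linarith) hn
        _ ≤ D₂.card := by nlinarith
    exact_mod_cast hreal
  -- every vertex of `D₂` reaches a vertex of `T` (the far end of its path component)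
  have hleaf : ∀ x ∈ D₂, ∃ w ∈ T, (gr E₂).Reachable x w := by
    intro x hx
    set C := D₂.filter fun y => (gr E₂).Reachable x y with hC
    have hxC : x ∈ C := mem_filter.2 ⟨hx, Reachable.refl _⟩
    obtain ⟨y, hyC, hymax⟩ := exists_max_image C (fun y => (gr E₂).dist x y) ⟨x, hxC⟩
    obtain ⟨hyD, hxy⟩ := mem_filter.1 hyC
    refine ⟨y, mem_filter.2 ⟨hyD, ?_⟩, hxy⟩
    by_contra hy2
    have hy2' : edeg E₂ y = 2 := le_antisymm (hfdeg y) (by omega)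
    obtain ⟨e₁, e₂, hne, hpair⟩ := card_eq_two.1 hy2'
    have hm : ∀ e, e ∈ ({e₁, e₂} : Finset (Sym2 V)) → e ∈ E₂ ∧ y ∈ e := fun e he => by
      rw [← hpair] at he; exact mem_filter.1 he
    -- the other endpoints
    have hother : ∀ e ∈ ({e₁, e₂} : Finset (Sym2 V)), ∃ z, e = s(y, z) ∧ (gr E₂).Adj y z := by
      intro e he
      obtain ⟨heE, hye⟩ := hm e he
      induction e using Sym2.ind with
      | h p q =>
        have hpq : p ≠ q := fun h => hloop₂ _ heE (by subst h; simp)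
        rcases Sym2.mem_iff.1 hye with rfl | rfl
        · exact ⟨q, rfl, gr_adj.2 ⟨heE, hpq⟩⟩
        · exact ⟨p, Sym2.eq_swap, gr_adj.2 ⟨Sym2.eq_swap ▸ heE, Ne.symm hpq⟩⟩
    obtain ⟨y₁, rfl, hadj₁⟩ := hother e₁ (by simp)
    obtain ⟨y₂, rfl, hadj₂⟩ := hother e₂ (by simp)
    have hy₁₂ : y₁ ≠ y₂ := fun h => hne (by rw [h])
    -- both neighbours are in `C`, hence not farther than `y`; in a forest they are one step closer
    have hcloser : ∀ z, (gr E₂).Adj y z → (gr E₂).dist x y = (gr E₂).dist x z + 1 := by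
      intro z hz
      have hzC : z ∈ C := mem_filter.2 ⟨(mem_of_adj_filter hz).2, hxy.trans hz.reachable⟩
      have hle := hymax z hzC
      rcases hacyc.dist_eq_dist_add_one_of_adj_of_reachable x hz hxy with h | h
      · exact h
      · omega
    -- two distinct paths from `x` to `y`
    obtain ⟨q₁, hq₁, hq₁l⟩ := (hxy.trans hadj₁.reachable).exists_path_of_dist
    obtain ⟨q₂, hq₂, hq₂l⟩ := (hxy.trans hadj₂.reachable).exists_path_of_dist
    have hP₁ : (q₁.concat hadj₁.symm).IsPath :=
      Walk.isPath_of_length_eq_dist _ (by rw [Walk.length_concat, hq₁l, hcloser y₁ hadj₁])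
    have hP₂ : (q₂.concat hadj₂.symm).IsPath :=
      Walk.isPath_of_length_eq_dist _ (by rw [Walk.length_concat, hq₂l, hcloser y₂ hadj₂])
    have heq := hacyc.path_unique ⟨_, hP₁⟩ ⟨_, hP₂⟩
    have hw : (q₁.concat hadj₁.symm).penultimate = (q₂.concat hadj₂.symm).penultimate := by
      have := congrArg Subtype.val heq
      simp only at this
      rw [this]
    rw [Walk.penultimate_concat, Walk.penultimate_concat] at hw
    exact hy₁₂ hw
  -- pigeonhole: some `w ∈ T` is reached from `≥ l + 2` vertices of `D₂`
  have hD₂ne : D₂.Nonempty := by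
    rw [← card_pos]
    have : 1 ≤ T.card ∨ T.card = 0 := by omega
    rcases this with h | h
    · nlinarith
    · -- `T = ∅` forces `D₂ = ∅`? no: use `hleaf` on any vertex; if `D₂ = ∅` we derive a contradiction
      -- with `2 ≤ |E|`: all support vertices are branch vertices, `3n ≤ 2e ≤ 2(1+η)n`, `η < 1/2`.
      by_contra h0
      push Not at h0
      have hD0 : D₂.card = 0 := by omega
      have hsum := sum_edeg E hloop
      have h3 : 3 * S.card ≤ 2 * E.card := by
        rw [← hsum, mul_comm, ← smul_eq_mul, ← sum_const]
        refine sum_le_sum fun v hv => ?_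
        have h2v := hdeg2 v hv
        have : v ∉ D₂ := fun h' => by rw [card_eq_zero.1 hD0] at h'; simp at h'
        have : edeg E v ≠ 2 := fun h'' => this (mem_filter.2 ⟨hv, h''⟩)
        omega
      have hSpos : 0 < S.card := by
        obtain ⟨e, he⟩ := card_pos.1 (by omega : 0 < E.card)
        induction e using Sym2.ind with
        | h x y => exact card_pos.2 ⟨x, mem_supp.2 ⟨_, he, Sym2.mem_mk_left _ _⟩⟩
      have e1 : (3 : ℝ) * S.card ≤ 2 * E.card := by exact_mod_cast h3
      have e2 : (0 : ℝ) < S.card := by exact_mod_cast hSpos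
      have hη1 : η * 14 ≤ 1 := by
        have : (0 : ℝ) ≤ l := Nat.cast_nonneg _
        nlinarith
      nlinarith
  obtain ⟨x₀, hx₀⟩ := hD₂ne
  obtain ⟨w₀, hw₀T, -⟩ := hleaf x₀ hx₀
  have hTne : T.Nonempty := ⟨w₀, hw₀T⟩
  -- choose the leaf map
  choose f hf using hleaf
  obtain ⟨w, hwT, hfib⟩ := Finset.exists_le_card_fiber_of_mul_le_card_of_maps_to
    (s := D₂.attach) (t := T) (f := fun x => f x.1 x.2) (fun x _ => (hf x.1 x.2).1) hTne
    (n := l + 2) (by rw [card_attach, mul_comm]; exact hcount)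
  -- the class of `w`
  set C := D₂.filter fun y => (gr E₂).Reachable w y with hC
  have hCcard : l + 2 ≤ C.card := by
    refine hfib.trans (Finset.card_le_card_of_injOn (fun x => x.1) (fun x hx => ?_) (fun x _ x' _ h => Subtype.ext h))
    obtain ⟨-, hxw⟩ := mem_filter.1 hx
    have hr : (gr E₂).Reachable x.1 w := by rw [← hxw]; exact (hf x.1 x.2).2
    exact mem_coe.2 (mem_filter.2 ⟨x.2, hr.symm⟩)
  obtain ⟨hwD, hwdeg⟩ := mem_filter.1 hwT
  obtain ⟨y, hyC, hfar⟩ := exists_far_of_card hfdeg hwdeg C (fun y hy => (mem_filter.1 hy).2) hCcard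
  -- the geodesic from `w` to `y`
  obtain ⟨p, hp, hpl⟩ := ((mem_filter.1 hyC).2).exists_path_of_dist
  set n := p.length with hn
  have hln : l ≤ n := by omega
  have hinj : ∀ i j, i ≤ n → j ≤ n → p.getVert i = p.getVert j → i = j := fun i j hi hj h =>
    hp.getVert_injOn (by simpa using hi) (by simpa using hj) h
  obtain ⟨hP, hb⟩ := hbare (fun i => p.getVert i) n hinj fun i hi => p.adj_getVert_succ hi
  exact ⟨fun i => p.getVert i, n, hln, hinj, hP, hb⟩

/-- **[ABLT06] Lemma 2.12 / [CMM10] Lemma 3.6, deterministic part: sparse edge sets of large girth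
are path decomposable.**  If `E` is loopless, every cycle of `gr E` has length `≥ l + 1`, and
every sub-edge-set `E' ⊆ E` with `≥ 2` edges satisfies `|E'| ≤ (1+η)|supp E'|` with
`η(6l + 14) ≤ 1`, then `E` is `l`-path decomposable (`Multicut.PathDecomposable l E`).
[cite: AroraBollobasLovaszTourlakis2006, Lemma 2.12 (p. 28); CharikarMakarychevMakarychev2010, Lemma 3.6 (p. 19)] -/
theorem pathDecomposable_of_sparse (E : Finset (Sym2 V)) (hloop : ∀ e ∈ E, ¬ e.IsDiag) {η : ℝ}
    {l : ℕ} (hη : η * (6 * l + 14) ≤ 1)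
    (hsparse : ∀ E' ⊆ E, 2 ≤ E'.card → (E'.card : ℝ) ≤ (1 + η) * (supp E').card)
    (hgirth : ∀ (u : V) (c : (gr E).Walk u u), c.IsCycle → l + 1 ≤ c.length) :
    PathDecomposable l E := by
  intro E' hE' h2 hsep
  exact exists_barePath_of_sparse hsep h2 (fun e he => hloop e (hE' he)) hη (hsparse E' hE' h2)
    (girth_mono hE' hgirth)

end Multicut

end Literature.Combinatorics.Optimization
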